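import Mathlib.Analysis.SpecialFunctions.Pow.Real
import Mathlib.Tactic.Linarith
import Mathlib.Tactic.FieldSimp
import Mathlib.Tactic.Positivity
import HarnessLib

/-!
# Barrier: the Aoki-phase dichotomy (Sharpe–Singleton 1998) — at non-zero lattice spacing Wilson fermions have no chirally restored massless point: the pions become massless only on the boundary of a flavour–parity broken (Aoki) phase, or not at all (minimum pion mass of order `a`)

Barrier catalogue `Literature/Barriers/QuantumFields/` (D-0021), summit `QuantumFields`,
sub-problem `ChiralRegime` = `QCDChiralOf 2 ∧ QCDChiralOf 3` (draft
`docs/m5/drafts/QuantumFields.ChiralRegime.Statement.lean`): Wilson quarks (`r = 1`), bare masses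
`m_f(k) = m_crit(k) + a_k m_f/Z_m(k)` driven towards the critical line `κ_c(β)` of vanishing pion
mass; clause `ReachesChiralRegime` (arbitrarily small lattice gaps, in physical units, at small
positive renormalised masses, ALONG `a_k → 0`).

## The printed result (Sharpe–Singleton, Phys. Rev. D 58 (1998) 074501, hep-lat/9804028)

Two-flavour lattice QCD with Wilson fermions near the continuum limit is described by the continuum
chiral Lagrangian plus terms in powers of `a` (§4). Keeping the mass term (with the Pauli term
absorbed by `m → m + aΛ²`) to second order, the potential energy is
`𝒱_χ = -(c₁/4) Tr(Σ + Σ†) + (c₂/16) {Tr(Σ + Σ†)}²`, with, for shifted masses `m'` of `O(a²)`,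
`c₁ ∼ m'Λ³`, `c₂ ∼ a²Λ⁶` — "The crucial point is that `c₁ ∼ c₂`, and so the two terms in the
potential are comparable" (§4). Writing `Σ = A + iB·σ`, `A² + B² = 1`, "the potential becomes
`𝒱_χ = -c₁A + c₂A²`, where the parameter `A` is constrained to lie between `-1` and `+1`
inclusive … A non-zero value of `B₀` can occur only when `|A₀|` is strictly less than one" and
`B₀ ≠ 0` breaks flavour `SU(2)_V → U(1)` (and parity). With `ε = c₁/2c₂`:
* `c₂ > 0`: minimum of the parabola at `A_m = ε`; "If this minimum lies outside the range `-1` to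
  `1`, then `A₀` is forced to one of the boundary points `|A₀| = 1` … `Σ₀ = ±1`, and hence the
  vector symmetry `SU(2)_V` is not spontaneously broken … If instead `|A_m| < 1`, then the vacuum
  is determined by `A₀ = A_m` and `B₀ ≠ 0` … the region `-1 < ε < 1` thus has the properties of
  the Aoki phase"; pion masses `m₁² = m₂² = 0`, `m₃²f_π²/2c₂ = 1 - ε²` for `|ε| ≤ 1` and
  `m_a²f_π²/2c₂ = |ε| - 1` for `|ε| ≥ 1`: "the pions `π₁,₂` are the Goldstone bosons of the broken
  flavor symmetry within the Aoki phase, and … all three pions are massless on the phase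
  boundaries"; width `Δm₀ ∼ a³`; and `ρ(0; m₀) ∝ √(1-ε²) ∝ m₃` for the overlap Hamiltonian
  `γ₅W(-m₀)` (gapless inside the phase);
* `c₂ < 0`: "the vacuum state is always at the edge of the allowed range of `A`, with `Σ₀ = +1`
  for `c₁ > 0` and `Σ₀ = -1` for `c₁ < 0` … the flavor symmetry is not spontaneously broken for any
  value of `ε`, and all three pions have the same non-zero mass, `m_a²f_π²/2|c₂| = 1 + |ε|` …
  Note that `m_a ∼ a` for `ε ∼ O(1)`."
"We find that there are two possible phase structures at non-zero lattice spacing: (1) there is an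
Aoki phase of width `Δm₀ ∼ a³` with two massless Goldstone pions; (2) there is no symmetry
breaking, and all three pions have an equal non-vanishing mass of order `a`" (abstract); the
analysis "is essentially unaltered" for non-perturbatively `O(a)`-improved Wilson fermions, "the
key discretization error is the `O(a²)` contribution to `c₂`" (§4). The phase was proposed by Aoki
(1984); the apparent conflict with the Vafa–Witten theorems is resolved in §6 ("The
inapplicability of the Vafa–Witten theorems": the flavour argument fails when `γ₅W(-m₀)` has a
non-vanishing density of zero eigenvalues, as it does in the Aoki phase; the parity argument does
not cover fermion bilinears), and the competing interpretation of Bitar–Heller–Narayanan is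
reconciled in §3, §5.

## What is vendored (all proved; no named fact)

The elementary extremal problem that carries the dichotomy, for real `c₁`, `c₂ ≠ 0`, `f ≠ 0`:
`AokiPhase.potential c₁ c₂ A = -c₁A + c₂A²` on `A ∈ [-1, 1]`; the flavour-symmetric vacuum
`A = ±1` (sign of `c₁`); its stability `AokiPhase.SymmetricVacuumStable` (it minimises the
potential on `[-1,1]`); the common pion mass-squared about it,
`AokiPhase.symmPionMassSq c₁ c₂ f = (|c₁| - 2c₂)/f²` (which is `2c₂(|ε|-1)/f²` for `c₂ > 0` and
`2|c₂|(1+|ε|)/f²` for `c₂ < 0`, the two printed formulas). THE BARRIER `AokiPhaseDichotomy`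
(proved, `AokiPhaseDichotomy_holds`): (i) massless pions in a stable flavour-symmetric vacuum occur
iff `c₂ > 0 ∧ |c₁| = 2c₂` — the two edges of the Aoki phase, nowhere for `c₂ < 0`; (ii) for
`c₂ > 0` and `|c₁| < 2c₂` the minimiser is the interior point `A₀ = ε`, `|A₀| < 1` (flavour–parity
breaking, `B₀² = 1 - ε² > 0`), strictly below both symmetric vacua; (iii) for `c₂ < 0` the
symmetric-vacuum pion mass-squared is `≥ 2|c₂|/f²` for every `c₁` (minimum pion mass of order
`a`). The chiral-Lagrangian input (form of `𝒱_χ`, sizes of `c₁, c₂`, mass formulas) is the cited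
effective-field-theory analysis, not derived here.

## References

[SharpeSingleton1998] [Aoki1984WilsonPhase] [BitarHellerNarayanan1998] [EdwardsHellerNarayanan1998]
[VafaWitten1984] [VafaWittenParity1984] [MontvayMunster1994] [JaffeWitten2000]
-/

noncomputable section

namespace Literature.Barriers.QuantumFields

namespace AokiPhase

/-- The Sharpe–Singleton potential `𝒱_χ(A) = -c₁A + c₂A²` of the flavour-symmetric component
`A = ¼Tr(Σ+Σ†) ∈ [-1,1]` of the condensate (`c₁ ∼ m'Λ³` linear in the shifted bare mass,
`c₂ ∼ a²Λ⁶` a lattice artefact of either sign). [cite: SharpeSingleton1998, §4 (potential in terms of A)] -/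
def potential (c₁ c₂ A : ℝ) : ℝ := -c₁ * A + c₂ * A ^ 2

/-- `ε = c₁/(2c₂)`, the position of the parabola's extremum. [cite: SharpeSingleton1998, §4] -/
def eps (c₁ c₂ : ℝ) : ℝ := c₁ / (2 * c₂)

/-- The flavour-symmetric vacuum `Σ₀ = ±1`, i.e. `A = sign c₁` (`+1` for `c₁ ≥ 0`).
[cite: SharpeSingleton1998, §4] -/
def symmVacuum (c₁ : ℝ) : ℝ := if 0 ≤ c₁ then 1 else -1

/-- **Stability of the flavour-symmetric vacuum**: `A = sign c₁` minimises the potential over the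
physical range `[-1, 1]` (no flavour–parity breaking condensate `B₀`). [cite: SharpeSingleton1998, §4] -/
def SymmetricVacuumStable (c₁ c₂ : ℝ) : Prop :=
  ∀ A : ℝ, -1 ≤ A → A ≤ 1 → potential c₁ c₂ (symmVacuum c₁) ≤ potential c₁ c₂ A

/-- **The common pion mass-squared about the flavour-symmetric vacuum**, `(|c₁| - 2c₂)/f²`:
expanding `A = ±(1 - Σ_a π_a²/(2f²))` in the potential gives `𝒱 = const + (|c₁|/2 - c₂)Σ_aπ_a²/f²`,
i.e. `m_a²f²/(2c₂) = |ε| - 1` for `c₂ > 0` and `m_a²f²/(2|c₂|) = 1 + |ε|` for `c₂ < 0`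
(`symmPionMassSq_eq_of_pos`, `symmPionMassSq_eq_of_neg`), the two printed formulas.
[cite: SharpeSingleton1998, §4 (pion masses for |ε| ≥ 1 and for c₂ < 0)] -/
def symmPionMassSq (c₁ c₂ f : ℝ) : ℝ := (|c₁| - 2 * c₂) / f ^ 2

/-- Value of the potential at the flavour-symmetric vacuum: `𝒱(±1) = -|c₁| + c₂`. [cite: SharpeSingleton1998, §4] -/
theorem potential_symmVacuum (c₁ c₂ : ℝ) : potential c₁ c₂ (symmVacuum c₁) = -|c₁| + c₂ := by
  unfold potential symmVacuum
  split_ifs with h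
  · rw [abs_of_nonneg h]; ring
  · rw [abs_of_neg (not_le.mp h)]; ring

/-- Printed form for `c₂ > 0`: `m_a² f²/(2c₂) = |ε| - 1`. [cite: SharpeSingleton1998, §4] -/
theorem symmPionMassSq_eq_of_pos {c₁ c₂ f : ℝ} (hc₂ : 0 < c₂) (hf : f ≠ 0) :
    symmPionMassSq c₁ c₂ f * f ^ 2 / (2 * c₂) = |eps c₁ c₂| - 1 := by
  unfold symmPionMassSq eps
  have hf2 : f ^ 2 ≠ 0 := pow_ne_zero 2 hf
  have h2 : (2 : ℝ) * c₂ ≠ 0 := by positivity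
  rw [abs_div, abs_of_pos (by positivity : (0:ℝ) < 2 * c₂), div_mul_cancel₀ _ hf2, sub_div,
    div_self h2]

/-- Printed form for `c₂ < 0`: `m_a² f²/(2|c₂|) = 1 + |ε|`. [cite: SharpeSingleton1998, §4] -/
theorem symmPionMassSq_eq_of_neg {c₁ c₂ f : ℝ} (hc₂ : c₂ < 0) (hf : f ≠ 0) :
    symmPionMassSq c₁ c₂ f * f ^ 2 / (2 * |c₂|) = 1 + |eps c₁ c₂| := by
  unfold symmPionMassSq eps
  have hf2 : f ^ 2 ≠ 0 := pow_ne_zero 2 hf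
  have h2 : (2 : ℝ) * c₂ < 0 := by linarith
  have h2ne : (2 : ℝ) * c₂ ≠ 0 := ne_of_lt h2
  rw [abs_div, abs_of_neg h2, abs_of_neg hc₂, div_mul_cancel₀ _ hf2,
    show (2 : ℝ) * -c₂ = -(2 * c₂) by ring, div_neg, div_neg, sub_div, div_self h2ne]
  ring

/-- **Stability criterion**: the flavour-symmetric vacuum minimises the potential on `[-1,1]`
iff `2c₂ ≤ |c₁|` (i.e. `c₂ ≤ 0`, or `c₂ > 0` with `|ε| ≥ 1`). [cite: SharpeSingleton1998, §4] -/
theorem symmetricVacuumStable_iff (c₁ c₂ : ℝ) :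
    SymmetricVacuumStable c₁ c₂ ↔ 2 * c₂ ≤ |c₁| := by
  constructor
  · intro h
    by_contra hlt
    rw [not_le] at hlt
    have hc₂ : 0 < c₂ := by linarith [abs_nonneg c₁]
    -- compare with the interior point A = ε
    have hε1 : |eps c₁ c₂| < 1 := by
      unfold eps
      rw [abs_div, abs_of_pos (by positivity : (0:ℝ) < 2 * c₂), div_lt_one (by positivity)]
      exact hlt
    have hmem := abs_lt.mp hε1
    have hle := h (eps c₁ c₂) hmem.1.le hmem.2.le
    rw [potential_symmVacuum] at hle
    unfold potential eps at hle
    -- V(sign c₁) - V(ε) = (2c₂ - |c₁|)²/(4c₂) > 0, contradiction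
    have key : -|c₁| + c₂ - (-c₁ * (c₁ / (2 * c₂)) + c₂ * (c₁ / (2 * c₂)) ^ 2) =
        (2 * c₂ - |c₁|) ^ 2 / (4 * c₂) := by
      have hc : c₂ ≠ 0 := ne_of_gt hc₂
      have hsq : c₁ ^ 2 = |c₁| ^ 2 := (sq_abs c₁).symm
      field_simp
      nlinarith [hsq]
    have hpos : 0 < (2 * c₂ - |c₁|) ^ 2 / (4 * c₂) := by
      apply div_pos _ (by positivity)
      have : 2 * c₂ - |c₁| ≠ 0 := by linarith
      positivity
    linarith
  · intro hstab A hA1 hA2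
    rw [potential_symmVacuum]
    unfold potential
    have hA : |A| ≤ 1 := abs_le.mpr ⟨hA1, hA2⟩
    have h1 : c₁ * A ≤ |c₁| * |A| := by
      calc c₁ * A ≤ |c₁ * A| := le_abs_self _
        _ = |c₁| * |A| := abs_mul _ _
    -- -|c₁| + c₂ ≤ -c₁A + c₂A²  ⇐  (1-|A|)(|c₁| - c₂(1+|A|)) ≥ 0
    have hsqA : A ^ 2 = |A| ^ 2 := (sq_abs A).symm
    have h3 : c₂ * A ^ 2 = c₂ * |A| ^ 2 := by rw [hsqA]
    have hfac : 0 ≤ |c₁| - c₂ * (1 + |A|) := by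
      rcases le_or_gt 0 c₂ with hc | hc
      · nlinarith [mul_nonneg hc (abs_nonneg A)]
      · nlinarith [mul_nonneg (le_of_lt (neg_pos.mpr hc)) (abs_nonneg A), abs_nonneg c₁]
    have hprod : 0 ≤ (1 - |A|) * (|c₁| - c₂ * (1 + |A|)) := mul_nonneg (by linarith) hfac
    nlinarith [hprod, h1, h3]

/-- **Massless pions about the symmetric vacuum** occur iff `|c₁| = 2c₂`. [cite: SharpeSingleton1998, §4] -/
theorem symmPionMassSq_eq_zero_iff {c₁ c₂ f : ℝ} (hf : f ≠ 0) :
    symmPionMassSq c₁ c₂ f = 0 ↔ |c₁| = 2 * c₂ := by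
  unfold symmPionMassSq
  rw [div_eq_zero_iff, sub_eq_zero]
  have : f ^ 2 ≠ 0 := pow_ne_zero 2 hf
  tauto

/-- **Scenario `c₂ > 0`, inside `|c₁| < 2c₂` (the Aoki phase): the minimiser is the interior
point `A₀ = ε`, `|A₀| < 1`**, strictly below both flavour-symmetric vacua — so `B₀² = 1 - ε² > 0`
and flavour–parity is spontaneously broken. [cite: SharpeSingleton1998, §4 (Aoki phase for -1 < ε < 1)] [cite: Aoki1984WilsonPhase] -/
theorem aoki_interior_minimiser {c₁ c₂ : ℝ} (hc₂ : 0 < c₂) (h : |c₁| < 2 * c₂) :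
    |eps c₁ c₂| < 1 ∧
      (∀ A : ℝ, potential c₁ c₂ (eps c₁ c₂) ≤ potential c₁ c₂ A) ∧
        potential c₁ c₂ (eps c₁ c₂) < potential c₁ c₂ 1 ∧
          potential c₁ c₂ (eps c₁ c₂) < potential c₁ c₂ (-1) := by
  have hc : c₂ ≠ 0 := ne_of_gt hc₂
  have hε : |eps c₁ c₂| < 1 := by
    unfold eps
    rw [abs_div, abs_of_pos (by positivity : (0:ℝ) < 2 * c₂), div_lt_one (by positivity)]
    exact h
  -- completing the square: V(A) - V(ε) = c₂ (A - ε)²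
  have hsq : ∀ A, potential c₁ c₂ A - potential c₁ c₂ (eps c₁ c₂) = c₂ * (A - eps c₁ c₂) ^ 2 := by
    intro A; unfold potential eps; field_simp; ring
  refine ⟨hε, fun A => ?_, ?_, ?_⟩
  · have := hsq A; nlinarith [mul_nonneg hc₂.le (sq_nonneg (A - eps c₁ c₂))]
  · have h1 : (1 - eps c₁ c₂) ≠ 0 := by
      have := (abs_lt.mp hε).2; linarith
    have := hsq 1
    have hpos : 0 < c₂ * (1 - eps c₁ c₂) ^ 2 := by positivity
    linarith
  · have h1 : (-1 - eps c₁ c₂) ≠ 0 := by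
      have := (abs_lt.mp hε).1; linarith
    have := hsq (-1)
    have hpos : 0 < c₂ * (-1 - eps c₁ c₂) ^ 2 := by positivity
    linarith

/-- **Scenario `c₂ < 0` (no Aoki phase): a minimum pion mass.** The symmetric-vacuum pion
mass-squared is at least `2|c₂|/f² > 0` for every bare mass (`c₁`): "all three pions have an equal
non-vanishing mass of order `a`". [cite: SharpeSingleton1998, §4 (c₂ < 0) and abstract (2)] -/
theorem firstOrder_mass_lower_bound {c₁ c₂ f : ℝ} (hc₂ : c₂ < 0) (hf : f ≠ 0) :
    2 * |c₂| / f ^ 2 ≤ symmPionMassSq c₁ c₂ f ∧ 0 < 2 * |c₂| / f ^ 2 := by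
  unfold symmPionMassSq
  have hf2 : 0 < f ^ 2 := by positivity
  refine ⟨?_, by have := abs_pos.mpr (ne_of_lt hc₂); positivity⟩
  rw [div_le_div_iff_of_pos_right hf2, abs_of_neg hc₂]
  linarith [abs_nonneg c₁]

/-- In scenario `c₂ < 0` the symmetric vacuum is stable for every `c₁` (no spontaneous flavour
breaking anywhere). [cite: SharpeSingleton1998, §4 (c₂ < 0)] -/
theorem firstOrder_symmetric_stable {c₁ c₂ : ℝ} (hc₂ : c₂ < 0) : SymmetricVacuumStable c₁ c₂ :=
  (symmetricVacuumStable_iff c₁ c₂).mpr (by linarith [abs_nonneg c₁])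

end AokiPhase

open AokiPhase

/-- **Barrier (Aoki-phase dichotomy for Wilson fermions at non-zero lattice spacing;
Sharpe–Singleton 1998, after Aoki 1984).** In the `O(a²)` chiral potential
`𝒱_χ(A) = -c₁A + c₂A²`, `A ∈ [-1,1]` (`c₁ ∼ m'Λ³` linear in the shifted bare quark mass,
`c₂ ∼ a²Λ⁶ ≠ 0` at `a ≠ 0`, pion decay constant `f ≠ 0`):
(i) massless pions about a STABLE flavour-symmetric vacuum `Σ₀ = ±1`
(`SymmetricVacuumStable c₁ c₂ ∧ symmPionMassSq c₁ c₂ f = 0`) occur if and only if `c₂ > 0` and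
`|c₁| = 2c₂` — the two second-order edges `ε = ±1` of the Aoki phase — and for no bare mass at all
when `c₂ < 0`;
(ii) when `c₂ > 0`, throughout `|c₁| < 2c₂` (a bare-mass interval of width `4c₂`, `Δm₀ ∼ a³`) the
minimiser is the interior point `A₀ = ε = c₁/2c₂`, `|A₀| < 1`, strictly below both symmetric
vacua: flavour `SU(2)_V → U(1)` and parity are spontaneously broken (`B₀ ≠ 0`), `π₁,₂` are its
Goldstone bosons and the overlap Hamiltonian `γ₅W(-m₀)` is gapless (`ρ(0;m₀) ∝ m₃`);
(iii) when `c₂ < 0`, the pion mass-squared about the (always stable) symmetric vacuum is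
`≥ 2|c₂|/f² > 0` for every bare mass: a minimum pion mass of order `a`.
So at non-zero lattice spacing there is NO bare mass at which Wilson-fermion QCD has massless
pions together with unbroken flavour–parity and a restored chiral symmetry: the massless point is
either the edge of a flavour–parity broken phase or absent. Proved below
(`AokiPhaseDichotomy_holds`); the effective-Lagrangian input is cited.
[cite: SharpeSingleton1998, abstract, §4 and §5] [cite: Aoki1984WilsonPhase]

BARRIER
technique_class: fixed-cutoff-chiral-limit, wilson-critical-line-as-massless-qcd, kappa-to-kappa-c-at-fixed-beta — any construction or argument that treats the Wilson critical line `κ_c(β)` (vanishing pion mass) at FIXED lattice spacing as a chirally symmetric massless theory: tuning `κ → κ_c(β)` at fixed `β` to obtain massless quarks/pions with unbroken flavour and parity, defining `m_crit(k)` as a point of exact chiral symmetry at step `k`, or extracting chiral-limit quantities by extrapolating in the bare mass to `κ_c` at fixed `a` as if no phase boundary intervened [cite: SharpeSingleton1998, §1 and §4] [cite: Aoki1984WilsonPhase]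
blocks: realising the light-pion physics demanded by `ReachesChiralRegime` of `ChiralRegime` = `QCDChiralOf 2 ∧ QCDChiralOf 3` (draft docs/m5/drafts/QuantumFields.ChiralRegime.Statement.lean) AT A FIXED STEP `k` in a flavour- and parity-symmetric way: at `a_k > 0` massless pions exist only as (a) the three massless pions ON the Aoki-phase boundary `|c₁| = 2c₂`, endpoints of a phase with condensate `⟨ψ̄ iγ₅σ₃ ψ⟩ ≠ 0` and two exactly massless flavour-Goldstone pions inside, or (b) not at all (`m_π² ≥ 2|c₂|/f²`, `m_π ∼ a`) (`AokiPhaseDichotomy`); it likewise blocks reading the additive mass renormalisation `m_crit` of the summit vocabulary (`QCDRegularisation.mcrit`) as more than the location of this boundary/minimum at each `β` [cite: SharpeSingleton1998, §4–§5]; NOT blocked: the statement's own route `a_k → 0`, along which the Aoki width `∼ a³` and the minimum pion mass `∼ a` vanish [cite: SharpeSingleton1998, abstract and §4]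
because: the Wilson term breaks chiral symmetry at `O(a)`; in the Symanzik/chiral effective theory the Pauli term shifts the mass (`m → m + aΛ²`) and the `O(a²)` term `c₂{Tr(Σ+Σ†)}²` competes with the mass term exactly when the shifted mass is `O(a²)` (`c₁ ∼ c₂`) [cite: SharpeSingleton1998, §4 ((c12) and the three mass regions)]; minimising `-c₁A + c₂A²` on `[-1,1]`: for `c₂ > 0` the vertex `ε = c₁/2c₂` enters the interval for `|c₁| < 2c₂`, forcing `|A₀| < 1`, `B₀ ≠ 0` (`aoki_interior_minimiser`), with `m₃²f²/2c₂ = 1-ε²` inside and `m_a²f²/2c₂ = |ε|-1` outside, zero only at `|ε| = 1` (`symmPionMassSq_eq_zero_iff`, `symmetricVacuumStable_iff`); for `c₂ < 0` the parabola is inverted, the vacuum sits at `A = ±1` and `m_a²f²/2|c₂| = 1+|ε| ≥ 1` (`firstOrder_mass_lower_bound`) [cite: SharpeSingleton1998, §4]; the gapless overlap Hamiltonian inside the phase (`ρ(0;m₀) ∝ √(1-ε²)`) is what defeats the Vafa–Witten flavour argument there, and the parity theorem does not cover fermion bilinears [cite: SharpeSingleton1998, §4 and §6] [cite: VafaWitten1984]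 [cite: VafaWittenParity1984]
evasions_known: take `a → 0` — "for any fixed physical quark-mass, the discretization errors are of `O(a²)` for small enough lattice spacing", the Aoki width shrinks like `a³` and the scenario-(2) mass like `a` [cite: SharpeSingleton1998, §4]; use the Aoki phase constructively — the flavour–parity breaking condensate is "a good order parameter … free from additive renormalization", its maximum inside the phase extrapolating to the continuum chiral condensate (Bitar–Heller–Narayanan as corrected in §5) [cite: BitarHellerNarayanan1998] [cite: SharpeSingleton1998, §5]; fermions with exact lattice chiral symmetry have a genuinely massless symmetric point at `a ≠ 0` (outside the Wilson regularisation hard-wired in `IsQCDAlong`) — see `Literature.Barriers.QuantumFields.NielsenNinomiya` (evasions) and `NoUltralocalGinspargWilson`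
scope_caveats: (a) what is proved is the elementary extremal problem for the printed potential and mass formulas; the form of `𝒱_χ`, the estimates `c₁ ∼ m'Λ³`, `c₂ ∼ a²Λ⁶`, the neglect of `c₃ ∼ a³Λ⁷` (valid up to a window `Δm₀ ∼ a⁴`) and of chiral logarithms, and the identification of `(|c₁|-2c₂)/f²` with the pion mass-squared are the cited effective-field-theory analysis for TWO degenerate flavours near the continuum limit [cite: SharpeSingleton1998, §4]; three flavours and strong coupling (where the proposal "has been established at strong coupling" with just two critical lines related by `m₀ → -(m₀+8)` [cite: SharpeSingleton1998, §2.1] [cite: Aoki1984WilsonPhase]) are not covered by the theorem; (b) the SIGN of `c₂` is not predicted ("The previous analysis cannot choose between the `c₂ > 0` and `c₂ < 0` cases — for this we must rely on simulations"), quenched evidence then favouring `c₂ > 0`, with the printed caveats that unquenching or higher orders in `a` could flip it [cite: SharpeSingleton1998, §4]; the barrier is the dichotomy, not either branch; (c) nothing here constrains the continuum limit or the clause `ReachesChiralRegime` taken along `a_k → 0`; (d) the interpretation dispute with Bitar–Heller–Narayanan (flavour–parity breaking vs. continuum chiral symmetry breaking) is printed as reconciled: "flavor-parity breaking can occur at any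 non-zero lattice spacing … one of only two options" [cite: SharpeSingleton1998, §5] [cite: BitarHellerNarayanan1998]
status: established — the effective-theory dichotomy [cite: SharpeSingleton1998]; the phase proposal [cite: Aoki1984WilsonPhase]; numerical context [cite: EdwardsHellerNarayanan1998] [cite: BitarHellerNarayanan1998]; the extremal problem proved below
-/
def AokiPhaseDichotomy : Prop :=
  ∀ c₁ c₂ f : ℝ, c₂ ≠ 0 → f ≠ 0 →
    ((SymmetricVacuumStable c₁ c₂ ∧ symmPionMassSq c₁ c₂ f = 0) ↔ (0 < c₂ ∧ |c₁| = 2 * c₂)) ∧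
    (0 < c₂ → |c₁| < 2 * c₂ →
      |eps c₁ c₂| < 1 ∧ (∀ A : ℝ, potential c₁ c₂ (eps c₁ c₂) ≤ potential c₁ c₂ A) ∧
        potential c₁ c₂ (eps c₁ c₂) < potential c₁ c₂ 1 ∧
          potential c₁ c₂ (eps c₁ c₂) < potential c₁ c₂ (-1)) ∧
    (c₂ < 0 → SymmetricVacuumStable c₁ c₂ ∧ 2 * |c₂| / f ^ 2 ≤ symmPionMassSq c₁ c₂ f ∧
      0 < 2 * |c₂| / f ^ 2)

/-- **Proof of the barrier `AokiPhaseDichotomy`** (from `symmetricVacuumStable_iff`,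
`symmPionMassSq_eq_zero_iff`, `aoki_interior_minimiser`, `firstOrder_mass_lower_bound`).
[cite: SharpeSingleton1998, §4] -/
theorem AokiPhaseDichotomy_holds : AokiPhaseDichotomy := by
  intro c₁ c₂ f hc₂ hf
  refine ⟨?_, fun hpos hlt => aoki_interior_minimiser hpos hlt, fun hneg =>
    ⟨firstOrder_symmetric_stable hneg, firstOrder_mass_lower_bound hneg hf⟩⟩
  rw [symmetricVacuumStable_iff, symmPionMassSq_eq_zero_iff hf]
  constructor
  · rintro ⟨_, heq⟩
    refine ⟨?_, heq⟩
    rcases lt_or_gt_of_ne hc₂ with h | h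
    · exfalso; linarith [abs_nonneg c₁]
    · exact h
  · rintro ⟨_, heq⟩
    exact ⟨le_of_eq heq.symm, heq⟩

/-- **Corollary (the massless symmetric point is a phase boundary).** Whenever massless pions sit
on a stable symmetric vacuum (`c₂ > 0`, `|c₁| = 2c₂`), every strictly smaller `|c₁'| < 2c₂` —
an interval of bare masses of width `4c₂ > 0` on the other side — lies in the flavour–parity
broken phase. [cite: SharpeSingleton1998, §4] -/
theorem AokiPhaseDichotomy.boundary_of_broken_phase (h : AokiPhaseDichotomy) {c₁ c₂ f : ℝ}
    (hc₂ : c₂ ≠ 0) (hf : f ≠ 0) (hstab : SymmetricVacuumStable c₁ c₂)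
    (hm : symmPionMassSq c₁ c₂ f = 0) :
    0 < c₂ ∧ |c₁| = 2 * c₂ ∧
      ∀ c₁' : ℝ, |c₁'| < |c₁| → |eps c₁' c₂| < 1 ∧
        potential c₁' c₂ (eps c₁' c₂) < potential c₁' c₂ 1 ∧
          potential c₁' c₂ (eps c₁' c₂) < potential c₁' c₂ (-1) := by
  obtain ⟨h1, h2, -⟩ := h c₁ c₂ f hc₂ hf
  obtain ⟨hpos, heq⟩ := h1.mp ⟨hstab, hm⟩
  refine ⟨hpos, heq, fun c₁' hlt => ?_⟩
  obtain ⟨-, h2', -⟩ := h c₁' c₂ f hc₂ hf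
  obtain ⟨hε, -, hlt1, hltm1⟩ := h2' hpos (by rw [← heq]; exact hlt)
  exact ⟨hε, hlt1, hltm1⟩

end Literature.Barriers.QuantumFields

end
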